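import Summits.NavierStokesRegularity.NavierStokesRegularity.Theses.HardyPointSink
import Literature.Analysis.FluidPDE.LocalTypeILiouville

/-!
# Route HardyPointSink — crux `NoHardyTypeIAncient` (stmt-NavierStokesRegularity-7980), line `birth`:
# steady fields with finite Type-I quantity have uniformly `L³` slices

Summit-side proof file (stub `hardyPointSink_cert_steadyL3` of the registered skeleton
`Cruxes/NoHardyTypeIAncient/Lines/birth.lean`), the elementary half of "steady witnesses are
excluded": if `u` is steady on `(−∞, 0)` (all slices equal), with a.e.-strongly measurable slices
and finite Albritton–Barker Type-I quantity
`𝐈 = typeIBound (Iio 0 ×ˢ univ) u p G < ∞`, then `‖u(t)‖_{L³} ≤ 𝐈^{1/3} < ∞` at every `t < 0`,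
in particular along `τ_k = −(k+1) → −∞`.

Proof (Type-I dilution): the cubic summand `C(Q) = r⁻² ∫_Q |u|³` of `𝐈` at the admissible
parabolic ball `Q = Q((0, 0), r) = (−r², 0) × B_r(0)` is at most `𝐈`; by steadiness the integrand
is `|u(−1, x)|³`, so Tonelli gives `C(Q) = r⁻² · r² ∫_{B_r(0)} |u(−1)|³ = ∫_{B_r(0)} |u(−1)|³ ≤ 𝐈`
for every `r > 0`, and `r → ∞` (monotone convergence over the balls `B_{n+1}(0)`) yields
`∫ |u(−1)|³ ≤ 𝐈`, i.e. `‖u(−1)‖_{L³} ≤ 𝐈^{1/3}`.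

## References

* D. Albritton, T. Barker, *On local Type I singularities of the Navier–Stokes equations and
  Liouville theorems*, J. Math. Fluid Mech. 21 (2019) no. 43 = arXiv:1811.00502, §1 (the displays
  defining `C` and `𝐈(ω)` after Thm 1.1).
-/

noncomputable section

set_option linter.dupNamespace false

open MeasureTheory Set Function Filter TopologicalSpace Metric
open scoped ENNReal NNReal Topology

namespace Summit.NavierStokesRegularity.NavierStokesRegularity.Theorems

/-- Tonelli for a function of the space variable alone over the parabolic ball
`Q((0, 0), r) = (−r², 0) × B_r(0)`: `∫_{Q((0,0), r)} g(x) d(t, x) = r² ∫_{B_r(0)} g` (`r ≥ 0`).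
[folklore] -/
theorem hardyPointSink_lintegral_parabolicCylinder_origin_snd
    {g : EuclideanSpace ℝ (Fin 3) → ℝ≥0∞} (hg : AEMeasurable g volume) {r : ℝ} (hr : 0 ≤ r) :
    ∫⁻ q in Literature.Analysis.FluidPDE.parabolicCylinder r
        ((0 : ℝ), (0 : EuclideanSpace ℝ (Fin 3))), g q.2 =
      ENNReal.ofReal r ^ 2 * ∫⁻ x in ball (0 : EuclideanSpace ℝ (Fin 3)) r, g x := by
  have hmeas : AEMeasurable (fun q : ℝ × EuclideanSpace ℝ (Fin 3) => g q.2)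
      (((volume : Measure ℝ).prod (volume : Measure (EuclideanSpace ℝ (Fin 3)))).restrict
        (Ioo ((0 : ℝ) - r ^ 2) 0 ×ˢ ball (0 : EuclideanSpace ℝ (Fin 3)) r)) :=
    hg.comp_snd.restrict
  rw [Literature.Analysis.FluidPDE.parabolicCylinder, Measure.volume_eq_prod,
    setLIntegral_prod _ hmeas]
  simp only [lintegral_const, Measure.restrict_apply_univ, Real.volume_Ioo, zero_sub,
    sub_neg_eq_add, zero_add, ENNReal.ofReal_pow hr]
  rw [mul_comm]

/-- **Type-I dilution for steady fields.** If all slices `u t`, `t < 0`, coincide, the slice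
`u (−1)` is a.e.-strongly measurable and `𝐈 = typeIBound (Iio 0 ×ˢ univ) u p G`, then
`∫ |u(−1)|³ ≤ 𝐈`: the cubic summand of `𝐈` at `Q((0, 0), r)` equals
`r⁻² · r² ∫_{B_r(0)} |u(−1)|³` by Tonelli, and `r → ∞`.
[cite: AlbrittonBarker2019, §1 (display defining C and 𝐈(ω) after Thm 1.1)] -/
theorem hardyPointSink_lintegral_cube_le_typeIBound_of_steady
    {u : ℝ → EuclideanSpace ℝ (Fin 3) → EuclideanSpace ℝ (Fin 3)}
    {p : ℝ → EuclideanSpace ℝ (Fin 3) → ℝ}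
    {G : ℝ → EuclideanSpace ℝ (Fin 3) → EuclideanSpace ℝ (Fin 3) →L[ℝ] EuclideanSpace ℝ (Fin 3)}
    (hmeas : AEStronglyMeasurable (u (-1)) volume) (hst : ∀ s < 0, ∀ t < 0, u s = u t) :
    ∫⁻ x, ‖u (-1) x‖ₑ ^ (3 : ℕ) ≤
      Literature.Analysis.FluidPDE.typeIBound
        (Iio (0 : ℝ) ×ˢ (univ : Set (EuclideanSpace ℝ (Fin 3)))) u p G := by
  have hg : AEMeasurable (fun x => ‖u (-1) x‖ₑ ^ (3 : ℕ)) volume :=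
    hmeas.aemeasurable.enorm.pow_const _
  -- Step 1: every ball `B_r(0)` contributes at most `𝐈`.
  have hball : ∀ r : ℝ, 0 < r →
      ∫⁻ x in ball (0 : EuclideanSpace ℝ (Fin 3)) r, ‖u (-1) x‖ₑ ^ (3 : ℕ) ≤
        Literature.Analysis.FluidPDE.typeIBound
          (Iio (0 : ℝ) ×ˢ (univ : Set (EuclideanSpace ℝ (Fin 3)))) u p G := by
    intro r hr
    -- `C(Q((0,0), r)) ≤ (A + C + D + E)(Q((0,0), r)) ≤ 𝐈`
    have hC : Literature.Analysis.FluidPDE.cknC r ((0 : ℝ), (0 : EuclideanSpace ℝ (Fin 3))) u ≤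
        Literature.Analysis.FluidPDE.typeIBound
          (Iio (0 : ℝ) ×ˢ (univ : Set (EuclideanSpace ℝ (Fin 3)))) u p G :=
      (le_add_right (le_add_right le_add_self)).trans
        (Literature.Analysis.FluidPDE.abScaledSum_le_typeIBound hr
          (Literature.Analysis.FluidPDE.parabolicCylinder_origin_subset_slab r))
    -- by steadiness the integrand of `C` only depends on the space variable
    have hcongr : ∫⁻ q in Literature.Analysis.FluidPDE.parabolicCylinder r
          ((0 : ℝ), (0 : EuclideanSpace ℝ (Fin 3))), ‖u q.1 q.2‖ₑ ^ (3 : ℕ) =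
        ∫⁻ q in Literature.Analysis.FluidPDE.parabolicCylinder r
          ((0 : ℝ), (0 : EuclideanSpace ℝ (Fin 3))), ‖u (-1) q.2‖ₑ ^ (3 : ℕ) := by
      refine setLIntegral_congr_fun
        (Literature.Analysis.FluidPDE.isOpen_parabolicCylinder r _).measurableSet ?_
      intro q hq
      rw [Literature.Analysis.FluidPDE.mem_parabolicCylinder] at hq
      have hq1 : q.1 < 0 := hq.1.2
      simp only [hst q.1 hq1 (-1) (by norm_num)]
    have hkey : (ENNReal.ofReal r ^ 2)⁻¹ * (ENNReal.ofReal r ^ 2 *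
        ∫⁻ x in ball (0 : EuclideanSpace ℝ (Fin 3)) r, ‖u (-1) x‖ₑ ^ (3 : ℕ)) ≤
        Literature.Analysis.FluidPDE.typeIBound
          (Iio (0 : ℝ) ×ˢ (univ : Set (EuclideanSpace ℝ (Fin 3)))) u p G := by
      have h := hC
      rw [Literature.Analysis.FluidPDE.cknC, hcongr,
        hardyPointSink_lintegral_parabolicCylinder_origin_snd hg hr.le] at h
      exact h
    have h0 : ENNReal.ofReal r ^ 2 ≠ 0 := pow_ne_zero 2 (ENNReal.ofReal_pos.2 hr).ne'
    have htop : ENNReal.ofReal r ^ 2 ≠ ⊤ := ENNReal.pow_ne_top ENNReal.ofReal_ne_top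
    rwa [ENNReal.inv_mul_cancel_left h0 htop] at hkey
  -- Step 2: `r → ∞` along the balls `B_{n+1}(0)`.
  have hdir : Directed (· ⊆ ·)
      (fun n : ℕ => ball (0 : EuclideanSpace ℝ (Fin 3)) ((n : ℝ) + 1)) := by
    refine Monotone.directed_le fun m n hmn => ball_subset_ball ?_
    exact_mod_cast Nat.add_le_add_right hmn 1
  calc ∫⁻ x, ‖u (-1) x‖ₑ ^ (3 : ℕ)
      = ∫⁻ x in ⋃ n : ℕ, ball (0 : EuclideanSpace ℝ (Fin 3)) ((n : ℝ) + 1),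
          ‖u (-1) x‖ₑ ^ (3 : ℕ) := by
        rw [iUnion_ball_nat_succ, setLIntegral_univ]
    _ = ⨆ n : ℕ, ∫⁻ x in ball (0 : EuclideanSpace ℝ (Fin 3)) ((n : ℝ) + 1),
          ‖u (-1) x‖ₑ ^ (3 : ℕ) :=
        setLIntegral_iUnion_of_directed _ hdir
    _ ≤ Literature.Analysis.FluidPDE.typeIBound
          (Iio (0 : ℝ) ×ˢ (univ : Set (EuclideanSpace ℝ (Fin 3)))) u p G :=
        iSup_le fun n => hball _ (by positivity)

/-- **Certificate `hardyPointSink_cert_steadyL3` (steady fields with `𝐈 < ∞` have uniformly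
`L³` slices).** If `u` is steady on `(−∞, 0)` (all slices equal), with measurable slices and
`𝐈(ℝ³ × ℝ₋) = typeIBound (Iio 0 ×ˢ univ) u p G < ∞`, then `‖u(t)‖_{L³} ≤ M < ∞` along
`τ_k = −(k+1) → −∞` (indeed at every `t`): the cubic term of `𝐈` at the cylinder `Q((0, 0), r)`
reads `C = r⁻² · r² ∫_{B_r(0)} |u|³ ≤ 𝐈` by Tonelli, and `r → ∞`; `M = 𝐈^{1/3}`. (Type-I
dilution; with `hardyPointSink_cert_L3seqLiouville` it excludes steady witnesses.)
[cite: AlbrittonBarker2019, §1 (display defining C and 𝐈(ω) after Thm 1.1)] -/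
theorem hardyPointSink_cert_steadyL3 :
    ∀ (u : ℝ → EuclideanSpace ℝ (Fin 3) → EuclideanSpace ℝ (Fin 3))
      (p : ℝ → EuclideanSpace ℝ (Fin 3) → ℝ)
      (G : ℝ → EuclideanSpace ℝ (Fin 3) → EuclideanSpace ℝ (Fin 3) →L[ℝ] EuclideanSpace ℝ (Fin 3)),
      (∀ t < 0, AEStronglyMeasurable (u t) volume) →
      Literature.Analysis.FluidPDE.typeIBound
        (Iio (0 : ℝ) ×ˢ (univ : Set (EuclideanSpace ℝ (Fin 3)))) u p G < ⊤ →
      (∀ s < 0, ∀ t < 0, u s = u t) →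
      ∃ (τ : ℕ → ℝ) (M : ℝ≥0∞), M < ⊤ ∧ Tendsto τ atTop atBot ∧ (∀ k, τ k < 0) ∧
        ∀ k, eLpNorm (u (τ k)) 3 volume ≤ M := by
  intro u p G hmeas hI hst
  -- the `L³` norm of the slice at time `-1` is at most `𝐈 ^ (1/3)`
  have hL3 : eLpNorm (u (-1)) 3 volume ≤
      Literature.Analysis.FluidPDE.typeIBound
        (Iio (0 : ℝ) ×ˢ (univ : Set (EuclideanSpace ℝ (Fin 3)))) u p G ^ (1 / 3 : ℝ) := by
    rw [eLpNorm_eq_lintegral_rpow_enorm_toReal three_ne_zero ENNReal.ofNat_ne_top]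
    simp only [ENNReal.toReal_ofNat]
    refine ENNReal.rpow_le_rpow ?_ (by norm_num)
    calc ∫⁻ x, ‖u (-1) x‖ₑ ^ (3 : ℝ) = ∫⁻ x, ‖u (-1) x‖ₑ ^ (3 : ℕ) :=
          lintegral_congr fun x => ENNReal.rpow_ofNat _ 3
      _ ≤ _ := hardyPointSink_lintegral_cube_le_typeIBound_of_steady
          (hmeas (-1) (by norm_num)) hst
  have hneg : ∀ k : ℕ, -((k : ℝ) + 1) < 0 := fun k => by
    have : (0 : ℝ) < (k : ℝ) + 1 := by positivity
    linarith
  refine ⟨fun k => -((k : ℝ) + 1),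
    Literature.Analysis.FluidPDE.typeIBound
      (Iio (0 : ℝ) ×ˢ (univ : Set (EuclideanSpace ℝ (Fin 3)))) u p G ^ (1 / 3 : ℝ),
    ENNReal.rpow_lt_top_of_nonneg (by norm_num) hI.ne, ?_, hneg, fun k => ?_⟩
  · exact tendsto_neg_atTop_atBot.comp
      (tendsto_atTop_add_const_right atTop (1 : ℝ) tendsto_natCast_atTop_atTop)
  · calc eLpNorm (u (-((k : ℝ) + 1))) 3 volume = eLpNorm (u (-1)) 3 volume := by
          rw [hst _ (hneg k) (-1) (by norm_num)]
      _ ≤ _ := hL3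

end Summit.NavierStokesRegularity.NavierStokesRegularity.Theorems

end
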